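import Literature.Probability.Percolation.CoveringStrictMonotonicity
import Literature.Barriers.CriticalPhenomena.SubexponentialGrowthZdProofs
import Mathlib.Combinatorics.SimpleGraph.Metric
import HarnessLib

/-!
# The quotient map `π : 𝒢 → 𝒢/Γ` of a graph by a group acting by automorphisms is a weak covering map

First file of the inline proof of `Literature.Probability.Percolation.MartineauSevero2019_cor22`
(Martineau–Severo 2019, Cor. 2.2: `p_c(𝒢) < p_c(𝒢/Γ)`). Martineau–Severo (Ann. Probab. 47 (2019), §2)
observe that the quotient map `π : x ↦ Γx` from `𝒢` to the quotient graph `ℋ = 𝒢/Γ` (vertices = orbits, two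
DISTINCT orbits adjacent iff an edge of `𝒢` meets both; the tree's `orbitQuotientGraph`) "is a weak covering
map, meaning that it is 1-Lipschitz for the graph distance and that it has the weak lifting property: for
every `x ∈ V(𝒢)` and every neighbour `u` of `π(x)`, there is a neighbour of `x` that is mapped to `u`", and
that weak covering maps lift paths. This file records exactly these deterministic facts for a group `Γ`
acting on `V(𝒢)` by graph automorphisms (`IsActionByAut`; freeness, when needed later, is the unfolded
hypothesis `∀ g x, g • x = x → g = 1` of the parent fact, i.e. Mathlib's `IsCancelSMul Γ V`), in the
vocabulary of the tree (`graphBall`,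
`ballVolume` of `Literature.Barriers.CriticalPhenomena.SubexponentialGrowthZd`, Mathlib's `SimpleGraph.dist`):

* `qmk Γ x` — the orbit `π x` of a vertex; `qmk_smul`, `qmk_eq_iff`;
* `quot_adj_iff`, `exists_adj_of_quot_adj` (weak lifting), `qmk_adj_or_eq` (`π` is a graph contraction);
* `qmk_mem_graphBall` (`π` is 1-Lipschitz on balls), `exists_lift_walk` (walk lifting with the same length),
  `graphBall_quot_eq_image` (`B_n(π x) = π(B_n(x))`);
* `smulIso` (the automorphism `x ↦ g • x`), `smul_mem_graphBall_iff` (the action is isometric);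
* `quotLocallyFinite` (a `LocallyFinite` structure on `ℋ`, noncomputable), `quot_degree_le`
  (`deg_ℋ(π x) ≤ deg_𝒢(x)`), `quot_connected`, `ballVolume_quot_le` (`|B_n(π x)| ≤ |B_n(x)|`).

Freeness of the action is not used here (cf. [MartineauSevero2019, §2]: "This fact does not use the freeness of
the action of `G` or quasi-transitivity").

## References

* S. Martineau, F. Severo, *Strict monotonicity of percolation thresholds under covering maps*, Ann. Probab.
  47 (2019), §1 (quotient graph), §2 (weak covering maps, lifting) [MartineauSevero2019].
* I. Benjamini, O. Schramm, *Percolation beyond `ℤ^d`*, Electron. Comm. Probab. 1 (1996), Thm. 1 [BenjaminiSchramm1996].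
-/

namespace Literature.Probability.Percolation

open Literature.Barriers.CriticalPhenomena

variable {V : Type*}

/-! ### Actions by graph automorphisms and the orbit map -/

/-- The group `Γ` acts on the vertices of `G` **by graph automorphisms**: every `g` preserves adjacency.
[cite: MartineauSevero2019, Cor. 2.2 ("a group acting on V(𝒢) by graph automorphisms")] -/
def IsActionByAut (G : SimpleGraph V) (Γ : Type*) [Group Γ] [MulAction Γ V] : Prop :=
  ∀ (g : Γ) (x y : V), G.Adj (g • x) (g • y) ↔ G.Adj x y

section Quot

variable (Γ : Type*) [Group Γ] [MulAction Γ V]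

/-- The orbit `π x = Γx` of a vertex, a vertex of the quotient graph (the quotient map `π : x ↦ Gx` of
[MartineauSevero2019, §2]). [cite: MartineauSevero2019, §2 (the quotient map π)] -/
abbrev qmk (x : V) : MulAction.orbitRel.Quotient Γ V := Quotient.mk (MulAction.orbitRel Γ V) x

/-- `π (g • x) = π x`. [folklore] -/
@[simp] theorem qmk_smul (g : Γ) (x : V) : qmk Γ (g • x) = qmk Γ x :=
  Quotient.sound (MulAction.orbitRel_apply.2 (MulAction.mem_orbit_iff.2 ⟨g, rfl⟩))

/-- `π x = π y ↔ ∃ g, g • y = x`. [folklore] -/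
theorem qmk_eq_iff (x y : V) : qmk Γ x = qmk Γ y ↔ ∃ g : Γ, g • y = x := by
  rw [qmk, qmk, Quotient.eq, MulAction.orbitRel_apply, MulAction.mem_orbit_iff]

/-- `π` is surjective. [folklore] -/
theorem qmk_surjective : Function.Surjective (qmk (V := V) Γ) :=
  Quotient.mk_surjective

variable {Γ}

/-- Adjacency in `ℋ = 𝒢/Γ` between two orbits `π x`, `π y`, for an action by automorphisms: the orbits are
distinct and `x` is adjacent to some translate of `y`. [cite: MartineauSevero2019, §1 (quotient graph 𝒢/G)] -/
theorem quot_adj_iff {G : SimpleGraph V} (hact : IsActionByAut G Γ) (x y : V) :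
    (orbitQuotientGraph G Γ).Adj (qmk Γ x) (qmk Γ y) ↔ qmk Γ x ≠ qmk Γ y ∧ ∃ g : Γ, G.Adj x (g • y) := by
  rw [orbitQuotientGraph_adj]
  refine and_congr_right fun _ => ⟨?_, ?_⟩
  · rintro ⟨a, b, ha, hb, hab⟩
    obtain ⟨g₁, rfl⟩ := (qmk_eq_iff Γ a x).1 ha
    obtain ⟨g₂, rfl⟩ := (qmk_eq_iff Γ b y).1 hb
    refine ⟨g₁⁻¹ * g₂, ?_⟩
    rw [← hact g₁, mul_smul, smul_inv_smul]
    exact hab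
  · rintro ⟨g, hg⟩
    exact ⟨x, g • y, rfl, qmk_smul Γ g y, hg⟩

/-- **Weak lifting property**: every neighbour `u` of `π x` in `ℋ` is the image of a neighbour of `x` in `𝒢`.
[cite: MartineauSevero2019, §2 (weak lifting property)] -/
theorem exists_adj_of_quot_adj {G : SimpleGraph V} (hact : IsActionByAut G Γ) {x : V}
    {u : MulAction.orbitRel.Quotient Γ V} (h : (orbitQuotientGraph G Γ).Adj (qmk Γ x) u) :
    ∃ y : V, G.Adj x y ∧ qmk Γ y = u := by
  obtain ⟨y, rfl⟩ := qmk_surjective Γ u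
  obtain ⟨-, g, hg⟩ := (quot_adj_iff hact x y).1 h
  exact ⟨g • y, hg, qmk_smul Γ g y⟩

/-- `π` is a graph contraction: adjacent vertices of `𝒢` have equal or adjacent images.
[cite: MartineauSevero2019, §2 (π is 1-Lipschitz)] -/
theorem qmk_adj_or_eq {G : SimpleGraph V} {x y : V} (h : G.Adj x y) :
    qmk Γ x = qmk Γ y ∨ (orbitQuotientGraph G Γ).Adj (qmk Γ x) (qmk Γ y) := by
  by_cases he : qmk Γ x = qmk Γ y
  · exact Or.inl he
  · exact Or.inr ((orbitQuotientGraph_adj G Γ _ _).2 ⟨he, x, y, rfl, rfl, h⟩)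

/-! ### Balls: `π` is 1-Lipschitz and lifts walks -/

/-- **`π` is 1-Lipschitz**: the end of a walk of length `n` from `x` projects into `B_n(π x)`.
[cite: MartineauSevero2019, §2 (π is 1-Lipschitz)] -/
theorem qmk_mem_graphBall_of_walk {G : SimpleGraph V} {x y : V} (w : G.Walk x y) :
    qmk Γ y ∈ graphBall (orbitQuotientGraph G Γ) (qmk Γ x) w.length := by
  induction w with
  | nil => exact mem_graphBall_self _ _ _
  | @cons a b c hab w ih =>
    rw [SimpleGraph.Walk.length_cons]
    rcases qmk_adj_or_eq (Γ := Γ) hab with he | hadj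
    · rw [he]
      exact graphBall_mono _ _ (Nat.le_succ _) ih
    · rw [graphBall_succ]
      refine Or.inr (Set.mem_iUnion₂.2 ⟨qmk Γ b, ?_, ih⟩)
      exact hadj

/-- `π (B_n(x)) ⊆ B_n(π x)`. [cite: MartineauSevero2019, §2 (π is 1-Lipschitz)] -/
theorem qmk_mem_graphBall {G : SimpleGraph V} {x y : V} {n : ℕ} (h : y ∈ graphBall G x n) :
    qmk Γ y ∈ graphBall (orbitQuotientGraph G Γ) (qmk Γ x) n := by
  obtain ⟨w, hw⟩ := h
  exact graphBall_mono _ _ hw (qmk_mem_graphBall_of_walk w)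

/-- **Walk lifting**: a walk of `ℋ` from `π x` lifts to a walk of `𝒢` from `x` of the same length
("weak covering maps … can also lift trees"; here paths suffice). [cite: MartineauSevero2019, §2 (lifting)] -/
theorem exists_lift_walk {G : SimpleGraph V} (hact : IsActionByAut G Γ) {a u : MulAction.orbitRel.Quotient Γ V}
    (w : (orbitQuotientGraph G Γ).Walk a u) {x : V} (hx : qmk Γ x = a) :
    ∃ y : V, qmk Γ y = u ∧ ∃ w' : G.Walk x y, w'.length = w.length := by
  induction w generalizing x with
  | nil => exact ⟨x, hx, SimpleGraph.Walk.nil, rfl⟩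
  | @cons a b c hab w ih =>
    subst hx
    obtain ⟨x₁, hx₁, hb⟩ := exists_adj_of_quot_adj hact hab
    obtain ⟨y, hy, w', hw'⟩ := ih hb
    exact ⟨y, hy, SimpleGraph.Walk.cons hx₁ w', by rw [SimpleGraph.Walk.length_cons, hw']; rfl⟩

/-- **`B_n(π x) = π(B_n(x))`**: `π` maps balls onto balls (1-Lipschitz and walk lifting).
[cite: MartineauSevero2019, §7 proof of Lemma 7.2 ("As π(B_r(x)) = B_r(π(x))")] -/
theorem graphBall_quot_eq_image {G : SimpleGraph V} (hact : IsActionByAut G Γ) (x : V) (n : ℕ) :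
    graphBall (orbitQuotientGraph G Γ) (qmk Γ x) n = qmk Γ '' graphBall G x n := by
  ext u
  constructor
  · rintro ⟨w, hw⟩
    obtain ⟨y, hy, w', hw'⟩ := exists_lift_walk hact w rfl
    exact ⟨y, ⟨w', hw' ▸ hw⟩, hy⟩
  · rintro ⟨y, hy, rfl⟩
    exact qmk_mem_graphBall hy

/-! ### The action is isometric -/

/-- The graph automorphism `x ↦ g • x` of an action by automorphisms. [folklore] -/
def smulIso {G : SimpleGraph V} (hact : IsActionByAut G Γ) (g : Γ) : G ≃g G where
  toEquiv := MulAction.toPerm g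
  map_rel_iff' := hact g _ _

/-- `smulIso hact g x = g • x`. [folklore] -/
@[simp] theorem smulIso_apply {G : SimpleGraph V} (hact : IsActionByAut G Γ) (g : Γ) (x : V) :
    smulIso hact g x = g • x := rfl

/-- **The action is isometric on balls**: `g • y ∈ B_n(g • x) ↔ y ∈ B_n(x)`. [folklore] -/
theorem smul_mem_graphBall_iff {G : SimpleGraph V} (hact : IsActionByAut G Γ) (g : Γ) {x y : V} {n : ℕ} :
    g • y ∈ graphBall G (g • x) n ↔ y ∈ graphBall G x n := by
  constructor
  · intro h
    have := mem_graphBall_map (smulIso hact g⁻¹) h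
    simpa using this
  · intro h
    exact mem_graphBall_map (smulIso hact g) h

/-- Translating a ball: `g • B_n(x) = B_n(g • x)` (as an image). [folklore] -/
theorem image_smul_graphBall {G : SimpleGraph V} (hact : IsActionByAut G Γ) (g : Γ) (x : V) (n : ℕ) :
    (fun y => g • y) '' graphBall G x n = graphBall G (g • x) n := by
  ext z
  constructor
  · rintro ⟨y, hy, rfl⟩
    exact (smul_mem_graphBall_iff hact g).2 hy
  · intro hz
    refine ⟨g⁻¹ • z, ?_, smul_inv_smul g z⟩
    rw [← smul_mem_graphBall_iff hact g, smul_inv_smul]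
    exact hz

/-! ### Local finiteness, degrees, connectedness and volumes of the quotient -/

/-- The neighbours of `π x` in `ℋ` are images of neighbours of `x`. [cite: MartineauSevero2019, §2 (weak lifting)] -/
theorem neighborSet_quot_subset {G : SimpleGraph V} (hact : IsActionByAut G Γ) (x : V) :
    (orbitQuotientGraph G Γ).neighborSet (qmk Γ x) ⊆ qmk Γ '' G.neighborSet x := by
  intro u hu
  obtain ⟨y, hy, rfl⟩ := exists_adj_of_quot_adj hact hu
  exact ⟨y, hy, rfl⟩

/-- **`ℋ = 𝒢/Γ` is locally finite** when `𝒢` is and `Γ` acts by automorphisms (a `LocallyFinite` structure,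
noncomputable: neighbour sets are finite images). [cite: MartineauSevero2019, §2 (Convention: graphs locally finite)] -/
@[reducible] noncomputable def quotLocallyFinite {G : SimpleGraph V} [G.LocallyFinite] (hact : IsActionByAut G Γ) :
    (orbitQuotientGraph G Γ).LocallyFinite := fun u =>
  (Set.Finite.subset (by
    obtain ⟨x, rfl⟩ := qmk_surjective Γ u
    exact ((G.neighborSet x).toFinite.image _).subset (neighborSet_quot_subset hact x))
    (Set.Subset.refl _)).fintype

/-- **Degrees do not increase**: `deg_ℋ(π x) ≤ deg_𝒢(x)` (for any `LocallyFinite` structure on `ℋ`).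
[cite: MartineauSevero2019, §2 (weak lifting)] -/
theorem quot_degree_le {G : SimpleGraph V} [G.LocallyFinite] [DecidableEq (MulAction.orbitRel.Quotient Γ V)]
    [(orbitQuotientGraph G Γ).LocallyFinite] (hact : IsActionByAut G Γ) (x : V) :
    (orbitQuotientGraph G Γ).degree (qmk Γ x) ≤ G.degree x := by
  rw [← SimpleGraph.card_neighborFinset_eq_degree, ← SimpleGraph.card_neighborFinset_eq_degree]
  calc ((orbitQuotientGraph G Γ).neighborFinset (qmk Γ x)).card
      ≤ ((G.neighborFinset x).image (qmk Γ)).card := by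
        refine Finset.card_le_card fun u hu => ?_
        rw [SimpleGraph.mem_neighborFinset] at hu
        obtain ⟨y, hy, rfl⟩ := exists_adj_of_quot_adj hact hu
        exact Finset.mem_image.2 ⟨y, (SimpleGraph.mem_neighborFinset _ _ _).2 hy, rfl⟩
    _ ≤ (G.neighborFinset x).card := Finset.card_image_le

/-- A uniform degree bound passes to the quotient. [cite: MartineauSevero2019, Thm. 2.1 ("graphs of bounded degree")] -/
theorem quot_degree_le_of_degree_le {G : SimpleGraph V} [G.LocallyFinite]
    [(orbitQuotientGraph G Γ).LocallyFinite] (hact : IsActionByAut G Γ) {D : ℕ} (hD : ∀ v, G.degree v ≤ D)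
    (u : MulAction.orbitRel.Quotient Γ V) : (orbitQuotientGraph G Γ).degree u ≤ D := by
  classical
  obtain ⟨x, rfl⟩ := qmk_surjective Γ u
  exact (quot_degree_le hact x).trans (hD x)

/-- **`ℋ` is connected** when `𝒢` is. [cite: MartineauSevero2019, §2 (Convention: graphs connected)] -/
theorem quot_connected {G : SimpleGraph V} (hG : G.Connected) : (orbitQuotientGraph G Γ).Connected := by
  haveI : Nonempty (MulAction.orbitRel.Quotient Γ V) := ⟨qmk Γ hG.nonempty.some⟩
  refine ⟨fun a b => ?_⟩
  obtain ⟨x, rfl⟩ := qmk_surjective Γ a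
  obtain ⟨y, rfl⟩ := qmk_surjective Γ b
  obtain ⟨w⟩ := hG.preconnected x y
  obtain ⟨w', -⟩ := qmk_mem_graphBall_of_walk (Γ := Γ) w
  exact ⟨w'⟩

/-- **`|B_n(π x)| ≤ |B_n(x)|`** (the ball of `ℋ` is the image of the ball of `𝒢`).
[cite: MartineauSevero2019, §7 proof of Lemma 7.2] -/
theorem ballVolume_quot_le {G : SimpleGraph V} [G.LocallyFinite] (hact : IsActionByAut G Γ) (x : V) (n : ℕ) :
    ballVolume (orbitQuotientGraph G Γ) (qmk Γ x) n ≤ ballVolume G x n := by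
  rw [ballVolume, ballVolume, graphBall_quot_eq_image hact]
  exact Set.ncard_image_le (graphBall_finite G x n)

/-- If `π` is not injective on `B_n(x)` then `|B_n(π x)| < |B_n(x)|`.
[cite: MartineauSevero2019, §7 proof of Lemma 7.2 ("the cardinality of B_{r₀}(π(x_i)) is strictly less")] -/
theorem ballVolume_quot_lt {G : SimpleGraph V} [G.LocallyFinite] (hact : IsActionByAut G Γ) {x y z : V} {n : ℕ}
    (hy : y ∈ graphBall G x n) (hz : z ∈ graphBall G x n) (hyz : y ≠ z) (hq : qmk Γ y = qmk Γ z) :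
    ballVolume (orbitQuotientGraph G Γ) (qmk Γ x) n < ballVolume G x n := by
  rw [ballVolume, ballVolume, graphBall_quot_eq_image hact]
  refine lt_of_le_of_ne (Set.ncard_image_le (graphBall_finite G x n)) fun heq => hyz ?_
  exact Set.injOn_of_ncard_image_eq heq (graphBall_finite G x n) hy hz hq

/-- Conversely, `|B_n(π x)| < |B_n(x)|` forces two distinct points of `B_n(x)` in one fibre. [folklore] -/
theorem exists_ne_qmk_eq_of_ballVolume_lt {G : SimpleGraph V} [G.LocallyFinite] (hact : IsActionByAut G Γ)
    {x : V} {n : ℕ} (h : ballVolume (orbitQuotientGraph G Γ) (qmk Γ x) n < ballVolume G x n) :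
    ∃ y ∈ graphBall G x n, ∃ z ∈ graphBall G x n, y ≠ z ∧ qmk Γ y = qmk Γ z := by
  by_contra hne
  push Not at hne
  have hinj : Set.InjOn (qmk Γ) (graphBall G x n) := fun y hy z hz hyz => by
    by_contra h'
    exact hne y hy z hz h' hyz
  rw [ballVolume, ballVolume, graphBall_quot_eq_image hact, hinj.ncard_image] at h
  exact lt_irrefl _ h

end Quot

end Literature.Probability.Percolation
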